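import Summits.CriticalPhenomena.SAWScalingLimit.Theses.SAWTotalPositivity
import Literature.Probability.RandomPlanarGeometry.SAWStripPartitionFunction

/-!
# Line `critical-strip-gap` — crux stmt-CriticalPhenomena-10687 (`TPToTraversalBound`)

Crux (fixed, by name): `Summit.CriticalPhenomena.SAWScalingLimit.Theses.SAWTotalPositivity.TPToTraversalBound`
`= BoundaryTP2 → CriticalBubbleBound → SAWTraversalBound` (route `SAWTotalPositivity`, `Iff.rfl`; the
conclusion `SAWTraversalBound` is the Aizenman–Burchard hypothesis (H1) for the chordal critical SAW on
`δℤ²`, shared item stmt-CriticalPhenomena-1880).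

LINE (planner crux-plan, 2026-08-16; card `Lines/critical-strip-gap.md`; idea `Ideas/critical-strip-gap.md`,
triage TRIAGE-r1-1/2/3 all `pass` with sharpenings acted on below). "The conformal strip gap is the SAW's
RSW": the ENGINE is the multi-strand critical strip bound (S1, `MultiStrandStripGap`): `M` mutually
avoiding critical SAWs crossing an `n × ℓ` lattice rectangle lengthwise weigh at most `C^M e^{-a M² ℓ/n}`
(surface watermelon law `h_M ∝ M²`; `M = 1` is the ideator's `CriticalStripGap`, numerically
`(w+1)·a_w = 1.946/1.949/1.951 → 5π/8`). In a SQUARE annulus every inward crossing begins with a full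
short-direction crossing of one of the four straight frames, so `≥ 4M` disjoint crossings put `≥ M` strands
through ONE frame and cost `e^{-a M²/16}` per dyadic scale — super-linear in the crossing number, which is
exactly what (H1) (any `λ > 2` at a shell-dependent threshold) consumes. The ARCHITECTURE (merged with the
sibling card `radial-portal-transfer`, as all three triagers asked) is two-sided pinning at clean lattice
squares: conditionally on the walk outside a square, the pieces inside form a multi-strand critical system
with boundary data, so the fractal past is quarantined into DATA and every estimate lives in a clean square
(S3 `SquareCascadeContraction`, stated uniformly in the data with the allowance `K·(1 + #chargeable pairs)`;
S2 `CleanSquareDive` is the RSW-lower companion = the sibling's first lemma in lattice form). The top data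
of a tower is produced by the walk in the (dirty) domain: its long-excursion count has a single-scale tail
(S4 `TopExcursionTail`), and S5 (`stub_pinnedCascade`) is the Gibbs-pinning + polyline bookkeeping that turns
S3 + S4 into (H1) for INTERIOR shells (`closedBall x (4R) ⊆ D`). Shells meeting the boundary collar are the
declared residue of every clean-shape line (triage r1-3 (b)): S6 `BoundaryTraversalBound` is that IOU,
typed with (H1)'s own quantifier shape (Disproof F2/F3) so that a lattice Condition-G2 line
(target-switching-smlr / long-rooms) can discharge it by the Kemppainen–Smirnov template (arXiv:1212.6215,
Lemma 3.6 + Prop. 3.5). `composition` (sorry-free) glues interior + boundary shells into `SAWTraversalBound`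
(case split on the shell, `max`/`min` of the constants, monotonicity of `t ↦ (ρ/R)^t` on `(0,1]`), and
`TPToTraversalBound_of` concludes the crux BY NAME from the six registered `stub_*` theorems.

Disproof.lean (v6) obligations honoured: F1 — no `_false_without_` theorem can exist for this crux, so
none is cited; the line proves the consequent and uses `BoundaryTP2`/`CriticalBubbleBound` only as
mesh-scale junction hygiene inside S3 (F4: TP + B + planarity are consistent with ¬(H1), the SAW-specific
seed is S1). F2(iii)/(v), F3 — every (H1)-shaped statement here keeps `k` shell-dependent and `K λ δ₀`
domain-dependent and the `∃ δ₀` form (negatives index stmt-0772). F6/F7 (landed negative lemmas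
`Targets.not_annulusPairingGap`, `Targets.not_rimPushMonotone`) — no stub is an instance: S1–S3 are mesh-1
statements about finite families of lattice paths in `ℤ²` boxes (immune to coarse-mesh junk by F6's own
moral), S4–S6 inherit (H1)'s `δ ≤ δ₀`, `δ ≤ ρ` guards; nothing here asserts a pairing inequality or a rim
push. All objects are defined in this file over `zdGraph 2`, `SAW.stripSAWs`, `SAW.criticalFugacity`,
`SAW.law`, `Curve.HasTraversals` (no new Literature definition is assumed).
-/

noncomputable section

namespace Summit.CriticalPhenomena.SAWScalingLimit.Cruxes.TPToTraversalBound.CriticalStripGap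

open Summit.CriticalPhenomena.SAWScalingLimit.Theses.SAWTotalPositivity
open Literature.Probability.RandomPlanarGeometry Literature.Probability.LatticeModels
open Finset
open scoped ENNReal BigOperators

/-! ## Objects (lattice units, mesh 1 on `ℤ²`; all finite combinatorics) -/

open Classical in
/-- **`M`-strand strip partition function.** `Z^{(M)}_{n,ℓ}(i, j) = ∑ x_c^{|p₁|+⋯+|p_M|}` over `M`-tuples of
pairwise VERTEX-DISJOINT self-avoiding walks of `ℤ²` inside the box `{0,…,ℓ} × {1,…,n}`, the `m`-th from
`(0, i m)` to `(ℓ, j m)` (each factor ranges over the tree's `SAW.stripSAWs n ℓ s a b`, graded by the number of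
steps `s < (ℓ+1)n + 1`, which loses nothing by `SAW.stripSAWs_eq_empty`). For `M = 1` this is
`SAW.stripPartitionFunction n ℓ (i 0) (j 0)`; for `M = 0` it is `1`; tuples with a repeated endpoint are never
disjoint and contribute `0`. (The `M`-through-strand sector of the critical strip transfer matrix, summed over
a box of `ℓ + 1` columns.) -/
def multiStripPF (n ℓ M : ℕ) (i j : Fin M → ℤ) : ℝ :=
  ∑ s : Fin M → Fin ((ℓ + 1) * n + 1),
    SAW.criticalFugacity ^ (∑ m, (s m : ℕ)) *
      (((Fintype.piFinset fun m => SAW.stripSAWs n ℓ (s m) ![0, i m] ![(ℓ : ℤ), j m]).filter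
          fun p => ∀ m m', m ≠ m' → List.Disjoint (p m).support (p m').support).card : ℝ)

/-- Sup-distance `|v - c|_∞` on `ℤ²` (lattice squares are its balls). -/
def supDist (v c : Site 2) : ℕ := max (v 0 - c 0).natAbs (v 1 - c 1).natAbs

/-- **A strand system in the lattice square** `Q(c, N) = {|· - c|_∞ ≤ N}` with data `(u, v)`: `m` pairwise
vertex-disjoint self-avoiding walks of `ℤ²` inside the square, the `i`-th from `u i` to `v i` (endpoints
anywhere in the square; unrealisable data simply have no system). These are exactly the families of pieces
that a self-avoiding walk of a lattice domain containing `Q(c,N)` leaves inside the square, read with their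
order forgotten (two-sided domain Markov / Gibbs property of the weight `x_c^{|γ|}`). -/
structure SqSystem (c : Site 2) (N m : ℕ) (u v : Fin m → Site 2) where
  /-- the `i`-th strand -/
  walk : ∀ i, (zdGraph 2).Walk (u i) (v i)
  /-- each strand is self-avoiding -/
  isPath : ∀ i, (walk i).IsPath
  /-- each strand stays in the square `|· - c|_∞ ≤ N` -/
  inSq : ∀ i, ∀ w ∈ (walk i).support, supDist w c ≤ N
  /-- distinct strands are vertex-disjoint -/
  disjoint : ∀ i i', i ≠ i' → List.Disjoint (walk i).support (walk i').support

namespace SqSystem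

variable {c : Site 2} {N m : ℕ} {u v : Fin m → Site 2}

/-- Total number of steps of a system (its energy: the weight is `x_c ^ totalLength`). -/
def totalLength (σ : SqSystem c N m u v) : ℕ := ∑ i, (σ.walk i).length

end SqSystem

/-- **Inward-crossing counter** of a vertex list relative to an outer test `P` and an inner test `Q`:
scanning the list, an outer vertex ARMS the counter, and an inner vertex met while armed counts one
crossing and disarms. With `P = {|·-c|_∞ ≥ r_out}`, `Q = {|·-c|_∞ ≤ r_in}` (`r_in < r_out`) this is the number
of separate passages of the list from outside the square of half-width `r_out` into the square of half-width
`r_in` — the lattice currency of Aizenman–Burchard traversals. -/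
def crossCount (P Q : Site 2 → Prop) [DecidablePred P] [DecidablePred Q] : Bool → List (Site 2) → ℕ
  | _, [] => 0
  | armed, w :: l =>
    if P w then crossCount P Q true l
    else if Q w ∧ armed = true then crossCount P Q false l + 1
    else crossCount P Q armed l

/-- Number of inward crossings of the square annulus `r_in < |·-c|_∞ < r_out` by all strands of a system. -/
def SqSystem.crossings {c : Site 2} {N m : ℕ} {u v : Fin m → Site 2} (σ : SqSystem c N m u v)
    (rout rin : ℕ) : ℕ :=
  ∑ i, crossCount (fun w => rout ≤ supDist w c) (fun w => supDist w c ≤ rin) false (σ.walk i).support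

/-- Number of CHARGEABLE pairs of the data of the square `Q(c, N)`: the LONG pairs (endpoints at
sup-distance `≥ N/4`: their strands may dive at bounded cost, and lattice-dense nesting, which forces dives,
consists of long pairs) together with the pairs having an endpoint OFF the boundary layer `|·-c|_∞ = N`
(an endpoint planted inside the square can force an inward crossing outright; pinned data have at most the
two marked points there). Tiny grazing pairs on the layer — the bulk of any realistic data — are free. -/
def badPairs (c : Site 2) (N m : ℕ) (u v : Fin m → Site 2) : ℕ :=
  (univ.filter fun i =>
    N / 4 ≤ supDist (u i) (v i) ∨ supDist (u i) c ≠ N ∨ supDist (v i) c ≠ N).card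

open Classical in
/-- **Critical multi-strand partition function of the square with data and an event**:
`Z_{Q(c,N)}(u, v; P) = ∑_{σ ⊨ P} x_c^{totalLength σ}` in `[0, ∞]` (a finite sum: strands are paths in a
finite box). Conditional probabilities of the pinned system are ratios of these. -/
def sqPF (c : Site 2) (N m : ℕ) (u v : Fin m → Site 2) (P : SqSystem c N m u v → Prop) : ℝ≥0∞ :=
  ∑' σ : SqSystem c N m u v, if P σ then ENNReal.ofReal (SAW.criticalFugacity ^ σ.totalLength) else 0

/-- **Maximal runs of a vertex list inside a region**, recorded as (first vertex, last vertex) pairs (the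
accumulator holds the current run). Applied to the support of a chordal SAW and the region `Q(c,N)` these
are the data pairs of the pinned square system. -/
def runEnds (ins : Site 2 → Prop) [DecidablePred ins] :
    Option (Site 2 × Site 2) → List (Site 2) → List (Site 2 × Site 2)
  | none, [] => []
  | some p, [] => [p]
  | none, w :: l => if ins w then runEnds ins (some (w, w)) l else runEnds ins none l
  | some p, w :: l => if ins w then runEnds ins (some (p.1, w)) l else p :: runEnds ins none l

/-- Number of LONG excursions of a vertex list into the square `Q(c, N)`: maximal runs inside the square whose
first and last vertices are at sup-distance `≥ N/4` (same threshold as `badPairs`). -/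
def longExcursions (c : Site 2) (N : ℕ) (l : List (Site 2)) : ℕ :=
  ((runEnds (fun w => supDist w c ≤ N) none l).filter fun p => N / 4 ≤ supDist p.1 p.2).length

/-! ### Sanity of the counters (kernel-checked on small lists) -/

example : crossCount (fun w : Site 2 => 4 ≤ supDist w 0) (fun w => supDist w 0 ≤ 1) false
    [![5, 0], ![3, 1], ![1, 0], ![0, 0], ![4, 4], ![2, 0], ![0, 1]] = 2 := by decide

example : longExcursions 0 4 [![6, 0], ![4, 0], ![1, 1], ![4, 3], ![5, 3], ![4, 4], ![4, 5]] = 1 := by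
  decide

/-! ## Statements (the stub signatures refer to these by name) -/

/-- **S1 · ENGINE — the multi-strand critical strip gap `(CG_M)` in partition-function (`ℓ^∞`) form.**
There are `a > 0` and `C` such that for all `M`, all widths `n ≥ 1`, lengths `ℓ` and FIXED entry rows `i`,
`∑_{exit rows j} Z^{(M)}_{n,ℓ}(i, j) ≤ C^M · exp(-a M² ℓ / n)`: `M` mutually avoiding critical SAWs crossing
an `n × ℓ` rectangle lengthwise pay `e^{-a M²}` per unit of aspect ratio — the surface watermelon law
`-n log Λ_n^{(M)} → π h_M`, `h_M = M(3M+2)/8` (Duplantier–Saleur), of which only `∃ a > 0` is asserted, with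
the dilute regime `ℓ ≲ n/M` absorbed into `C^M`. `M = 1` is the ideator's `CriticalStripGap`
(numerics `(n+1)·a_n = 1.946, 1.949, 1.951` for `n = 2, 3, 4` against `5π/8 = 1.963`; exactly solvable
`n = 2`: rate `-log(x_c(1+x_c)) = 0.6487`); degenerate sectors are consistent (`M = n`: straight lines,
forces `a ≤ log μ`; `ℓ = 0`: `C ≥ (1+x_c)/(1-x_c) ≈ 2.22`; `M > n`: empty). OPEN (a quantitative
Hammersley–Whittington / bridge-decay statement; on the hexagonal lattice `B_T → 0` is known,
arXiv:1109.0358); certifiable for small `n, M` by a NEW `x_c` column transfer matrix (NOT the tree's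
`SAWStripTM`, which is Jensen's irreducible-bridge counter at fugacity `5/13` — triage r1-3). -/
@[conjecture] def MultiStrandStripGap : Prop :=
  ∃ a C : ℝ, 0 < a ∧ ∀ (M n ℓ : ℕ) (i : Fin M → ℤ), 1 ≤ n →
    ∑ j ∈ Fintype.piFinset (fun _ : Fin M => Finset.Icc (1 : ℤ) n), multiStripPF n ℓ M i j
      ≤ C ^ M * Real.exp (-(a * (M : ℝ) ^ 2 * ℓ / n))

/-- **S2 · RSW-LOWER COMPANION — clean square dive (the sibling card's first lemma, lattice form).**
There is `ε > 0` such that in every lattice square `Q(c, 2n)`, `n ≥ 1`, for every two vertices `u, v` of its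
boundary layer `|·-c|_∞ = 2n`, the critical weight of the SAWs from `u` to `v` inside the square that AVOID
the inner square `Q(c, n)` is at least `ε` times the weight of all SAWs from `u` to `v` inside the square
(Kemppainen–Smirnov Condition G1 at time zero for ONE clean shape, all boundary pairs, ratio form; the
`m = 1`, undecorated base case of the denominator of S3). Degenerate data consistent (`u = v`: both sides `1`,
`ε ≤ 1`; adjacent corners fine); endpoints strictly inside the annulus are deliberately excluded (from a
vertex adjacent to `Q(c,n)` avoidance is NOT uniformly likely). OPEN (an RSW-type LOWER bound; card data
for the top-row/forbidden-third variant: `0.93 → 0.91`, `N = 3 → 6`; kit job j006826). -/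
@[conjecture] def CleanSquareDive : Prop :=
  ∃ ε : ℝ, 0 < ε ∧ ∀ (c : Site 2) (n : ℕ) (u v : Site 2), 1 ≤ n → supDist u c = 2 * n →
    supDist v c = 2 * n →
      ENNReal.ofReal ε * sqPF c (2 * n) 1 ![u] ![v] (fun _ => True)
        ≤ sqPF c (2 * n) 1 ![u] ![v] (fun σ => ∀ w ∈ (σ.walk 0).support, n < supDist w c)

/-- **S3's conclusion · SQUARE CASCADE CONTRACTION (the typed "decorated docking", = the Transfer `C⁺`).**
For every `θ > 0` there are `K : ℕ` and `C` such that for every lattice square `Q(c, 2^J n₀)` (`n₀ ≥ 1`),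
every number `m` of strands and EVERY data `(u, v)` (arbitrary endpoints, arbitrarily many tiny grazing
pairs, arbitrary nesting — the combinatorial shadow of any fractal exterior), the critical weight of the
systems that make at least `K · (1 + L)` inward crossings of EACH dyadic annulus
`2^i n₀ < |·-c|_∞ < 2^{i+1} n₀`, `i < J`, is at most `C θ^J` times the total weight, where
`L = badPairs` counts the data pairs at sup-distance `≥ 2^J n₀ / 4` or with an endpoint off the boundary
layer. WHY THIS ALLOWANCE: a fixed allowance is false (opposite-side pairs dive typically, a fraction `η < 1`
of them; an endpoint planted inside forces a crossing), and heavy lattice-dense nesting (which FORCES dives)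
consists of long pairs; one checks that every FORCED inward crossing at any scale is carried by a chargeable
pair, one per pair, so with `K ≥ 1` the event always demands unforced excess, from the first scale on, and
the contraction is per scale and uniform in the data. WHY PLAUSIBLE: it is the clean-square, data-
conditioned form of (H1) itself (crossing cascades of SLE_{8/3}-like curves are subcritical across scales);
degenerate cases check (`m = 0` or `K(1+L) >` lattice capacity: left side `0`; `J = 0`: `C ≥ 1`). HOW THE
LINE PROVES IT (S3): frame reduction (each inward crossing starts with a full short crossing of one of the
four straight frames of its annulus, width `4·2^i n₀`, height `2^i n₀`; `≥ K(1+L)` crossings give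
`M ≥ K(1+L)/4` disjoint same-frame cores with BOTH endpoints fixed by the rest of the configuration) +
ENGINE S1 (cores weigh `≤ C^M e^{-a M²/16}` per scale, jointly — no Simon–Lieb split at a summed junction,
so BN1's `(r/δ)^{3/4}` loss never arises) + the DENOMINATOR docking (rerouting the excess strands shallowly
at linear cost `e^{-bM}` with the data and all other pieces kept: the open G-core, BN3; inputs S2 for the
undecorated single strand, `CriticalBubbleBound` for the exterior weight of tiny portals and
`BoundaryTP2`/`TPToHarnack` for O(1) re-anchoring at MESH scale, the only regime where TP₂ is sharp) +
cascade combinatorics (`M²` beats `bM`). -/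
@[conjecture] def SquareCascadeContraction : Prop :=
  ∀ θ : ℝ, 0 < θ → ∃ (K : ℕ) (C : ℝ), ∀ (c : Site 2) (n₀ J m : ℕ) (u v : Fin m → Site 2), 1 ≤ n₀ →
    sqPF c (2 ^ J * n₀) m u v
        (fun σ => ∀ i, i < J →
          K * (1 + badPairs c (2 ^ J * n₀) m u v) ≤ σ.crossings (2 ^ (i + 1) * n₀) (2 ^ i * n₀))
      ≤ ENNReal.ofReal (C * θ ^ J) * sqPF c (2 ^ J * n₀) m u v (fun _ => True)

/-- **S4 · TOP EXCURSION TAIL (single-scale, time zero; the only place the dirty exterior enters interior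
shells).** For every Dobrushin domain and endpoint approximation there are a shell allowance
`ℓ₀ : ℂ → ℝ → ℕ`, constants `C`, `κ > 0` and `δ₀ > 0` such that for `δ ≤ δ₀`, every `x, R > 0` with
`closedBall x (4R) ⊆ D`, every lattice square `Q(c, N)` centred within `δ` of `x` with `R/8 ≤ Nδ ≤ R/4`, and
every `ℓ`, the chordal critical SAW has at least `ℓ₀(x,R) + ℓ` LONG excursions into `Q(c,N)` (maximal
pieces inside the square with ends `≥ N/4` apart — the pinned data's `badPairs` are these plus at most the
two pieces ending at the marked points) with
probability `≤ C e^{-κ ℓ}`. The allowance absorbs every deterministic effect of `∂D` near `B(x, 4R)`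
(fingers/meanders along the clean collar make many long excursions typical, cf. Disproof F3's near-misses:
nothing uniform in the shell can hold); beyond it each long excursion is unforced AND unfavoured because
`D` is simply connected (a route favouring a deep shortcut through the clean square would enclose a hole).
A Kemppainen–Smirnov-type statement (sup over domains = sup over pasts for the exactly domain-Markov SAW,
KS17 Remark 2.8), but ONE scale, no power law, and with the excursions landing in a CLEAN square; shared
with `radial-portal-transfer`'s `TopState`. OPEN. -/
@[conjecture] def TopExcursionTail : Prop :=
  ∀ (D : DobrushinDomain) (a b : ℝ → Site 2), SAW.IsEndpointApprox D a b →
    ∃ (ℓ₀ : ℂ → ℝ → ℕ) (C κ δ₀ : ℝ), 0 < κ ∧ 0 < δ₀ ∧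
      ∀ δ ∈ Set.Ioc (0 : ℝ) δ₀, ∀ (x : ℂ) (R : ℝ) (c : Site 2) (N ℓ : ℕ), 0 < R →
        Metric.closedBall x (4 * R) ⊆ D.carrier → dist (meshPoint δ c) x ≤ δ →
        R / 8 ≤ (N : ℝ) * δ → (N : ℝ) * δ ≤ R / 4 →
          SAW.law D.carrier δ (a δ) (b δ) {γ | ℓ₀ x R + ℓ ≤ longExcursions c N γ.walk.support}
            ≤ ENNReal.ofReal (C * Real.exp (-(κ * ℓ)))

/-- **Interior half of (H1)**: `SAWTraversalBound` verbatim, restricted to shells whose fourfold ball is inside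
the domain (`closedBall x (4R) ⊆ D`: the dyadic square tower from `ρ` to `R/4` and the double of its top
square are then clean lattice squares, all of whose vertices lie in `meshDomain D δ`). Quantifier shape of
(H1) kept on purpose (Disproof F2(iii), F3: `k` after the shell, `K λ δ₀` after the domain). -/
@[conjecture] def InteriorTraversalBound : Prop :=
  ∀ (D : DobrushinDomain) (a b : ℝ → Site 2), SAW.IsEndpointApprox D a b →
    ∃ (k : ℂ → ℝ → ℝ → ℕ) (K lam δ₀ : ℝ), 0 ≤ K ∧ 2 < lam ∧ 0 < δ₀ ∧
      ∀ δ ∈ Set.Ioc (0 : ℝ) δ₀, ∀ (x : ℂ) (ρ R : ℝ), δ ≤ ρ → ρ < R → R ≤ 1 →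
        Metric.closedBall x (4 * R) ⊆ D.carrier →
          SAW.law D.carrier δ (a δ) (b δ)
              {γ | (⟨γ.walk.toCurve (meshPoint δ)⟩ : Curve ℂ).HasTraversals (k x ρ R) x ρ R}
            ≤ ENNReal.ofReal (K * (ρ / R) ^ lam)

/-- **Boundary half of (H1)** (the IOU of every clean-shape line, triage r1-3 (b)): `SAWTraversalBound`
verbatim, restricted to shells whose fourfold ball MEETS the complement of the domain. No lever of this line
applies (the squares of the tower are cut by `∂D`, and a rough Jordan boundary at all scales is in scope
through the marked prime ends); intended discharge: a lattice Condition G2 for the critical SAW (the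
pocket/kernel lines) and the Kemppainen–Smirnov template KS17 Lemma 3.6 + Prop. 3.5 (index of an annulus,
`(n - n₀)/2` unforced crossings among `n`, with the shell-dependent `n₀` absorbed by `k`). -/
@[conjecture] def BoundaryTraversalBound : Prop :=
  ∀ (D : DobrushinDomain) (a b : ℝ → Site 2), SAW.IsEndpointApprox D a b →
    ∃ (k : ℂ → ℝ → ℝ → ℕ) (K lam δ₀ : ℝ), 0 ≤ K ∧ 2 < lam ∧ 0 < δ₀ ∧
      ∀ δ ∈ Set.Ioc (0 : ℝ) δ₀, ∀ (x : ℂ) (ρ R : ℝ), δ ≤ ρ → ρ < R → R ≤ 1 →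
        ¬ (Metric.closedBall x (4 * R) ⊆ D.carrier) →
          SAW.law D.carrier δ (a δ) (b δ)
              {γ | (⟨γ.walk.toCurve (meshPoint δ)⟩ : Curve ℂ).HasTraversals (k x ρ R) x ρ R}
            ≤ ENNReal.ofReal (K * (ρ / R) ^ lam)

/-! ## Registered stubs -/

/-- Registered stub `stub_multiStrandStripGap` (S1, ENGINE, XL/open, numerically supported, certifiable in
small cases): the multi-strand critical strip gap `MultiStrandStripGap`. Leans on: `SAW.stripSAWs`,
`SAW.stripPartitionFunction_eq_tsum`, `SAWBridges` / `SAWUnfolding` / `HammersleyWelshBound` /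
`SAWRenewalBound` (Kesten renewal is exact in a straight strip), `SAW.criticalFugacity_pos_lt_one` + the
PROVED `μ ∈ [2.6, 2.7]`. Proposed road (card): renewal inside the strip + "irreducible bridges are not flat"
+ monotonicity in `n` along `n = 2^k` with a doubling inequality; the `M²` from shared lateral confinement. -/
theorem stub_multiStrandStripGap : MultiStrandStripGap := by
  sorry

/-- Registered stub `stub_cleanSquareDive` (S2, RSW-lower companion, L/open): `CleanSquareDive`. Shared with
the sibling line `radial-portal-transfer` (its `CleanDiveSquare`, here at mesh 1 for all boundary pairs). -/
theorem stub_cleanSquareDive : CleanSquareDive := by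
  sorry

/-- Registered stub `stub_cascadeContraction` (S3, THE LINE'S CORE, XL): ENGINE + clean dive + the route's
two hypotheses as mesh-scale hygiene ⇒ `SquareCascadeContraction`. Internal cut foreseen for the lead (not
stubs): (i) frame reduction (deterministic, provable now); (ii) numerator = S1 on the same-frame cores with
both endpoints fixed (provable from S1); (iii) denominator docking — shallow rerouting of the excess strands
with the data and the other pieces KEPT (decoration-preserving; the open G-core; BN3 says it must be uniform
over clustered junction data, which is where `CriticalBubbleBound` and `BoundaryTP2` at mesh scale are
meant to act); (iv) the cascade combinatorics of the allowance `K(1+L)`. Uses `BoundaryTP2` and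
`CriticalBubbleBound` (Disproof F4: they cannot be the only input — S1/S2 are the SAW-specific seed). -/
theorem stub_cascadeContraction :
    MultiStrandStripGap → CleanSquareDive → BoundaryTP2 → CriticalBubbleBound →
      SquareCascadeContraction := by
  sorry

/-- Registered stub `stub_topExcursionTail` (S4, single-scale G-type tail, L/open): `TopExcursionTail`. -/
theorem stub_topExcursionTail : TopExcursionTail := by
  sorry

/-- Registered stub `stub_pinnedCascade` (S5, bookkeeping with content, L, provable from its hypotheses):
`SquareCascadeContraction → TopExcursionTail → InteriorTraversalBound`. Proof plan: (1) two-sided domain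
Markov / Gibbs pinning at the top square `Q(c, 2^J n₀)` of the dyadic tower (`n₀ = ⌈ρ/δ⌉ + 2`,
`2^J n₀ δ ∈ [R/8, R/4]`, all its vertices in `meshDomain D δ` because `closedBall x (4R) ⊆ D`): the law of
the event given the configuration outside the square is a ratio of `sqPF`'s with the induced data, so a
data-uniform ratio bound integrates to the same bound (`law ≤ 1`, Disproof §4); (2) polyline geometry:
`k` separate traversals of `D(x; ρ, R)` by `γ.walk.toCurve (meshPoint δ)` give `≥ ⌈k/2⌉ - 1` inward
crossings (`crossCount`) of every dyadic square annulus of the tower, summed over the pinned strands;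
(3) split on the top data (`badPairs ≤ longExcursions + 2`): `longExcursions + 3 ≤ (⌈k/2⌉ - 1)/K` ⇒ the
contraction event of S3 (weight `≤ C θ^J`, `θ = 1/8`, `J ≥ log₂(R/ρ) - 6`), else the tail of S4; choose
`k(x,ρ,R) := 2K(3 + ℓ₀(x,R) + ⌈(3/κ) log(R/ρ)⌉) + 2`, `λ = 3`, `K_D` from the two `C`'s, `δ₀` from S4. -/
theorem stub_pinnedCascade :
    SquareCascadeContraction → TopExcursionTail → InteriorTraversalBound := by
  sorry

/-- Registered stub `stub_boundaryShells` (S6, IOU, open — not this line's lever): `BoundaryTraversalBound`. -/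
theorem stub_boundaryShells : BoundaryTraversalBound := by
  sorry

/-! ## Composition (kernel-checked, no sorry, no stub used) -/

/-- GLUE: the interior and boundary halves give (H1) — threshold chosen per shell by the case
`closedBall x (4R) ⊆ D`, constants `max K`, `min λ`, `min δ₀`, and `(ρ/R)^{λ₁} ≤ (ρ/R)^{min λ}` on `(0,1]`. -/
theorem traversalBound_of_interior_of_boundary (hI : InteriorTraversalBound)
    (hB : BoundaryTraversalBound) : SAWTraversalBound := by
  classical
  intro D a b hab
  obtain ⟨k₁, K₁, l₁, δ₁, hK₁, hl₁, hδ₁, h₁⟩ := hI D a b hab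
  obtain ⟨k₂, K₂, l₂, δ₂, hK₂, hl₂, hδ₂, h₂⟩ := hB D a b hab
  refine ⟨fun x ρ R => if Metric.closedBall x (4 * R) ⊆ D.carrier then k₁ x ρ R else k₂ x ρ R,
    max K₁ K₂, min l₁ l₂, min δ₁ δ₂, le_max_of_le_left hK₁, lt_min hl₁ hl₂, lt_min hδ₁ hδ₂, ?_⟩
  intro δ hδ x ρ R hδρ hρR hR1
  have hρ : 0 < ρ := hδ.1.trans_le hδρ
  have hR : 0 < R := hρ.trans hρR
  have hq0 : 0 < ρ / R := div_pos hρ hR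
  have hq1 : ρ / R ≤ 1 := (div_le_one hR).2 hρR.le
  have mono : ∀ {K l : ℝ}, 0 ≤ K → K ≤ max K₁ K₂ → min l₁ l₂ ≤ l →
      ENNReal.ofReal (K * (ρ / R) ^ l) ≤ ENNReal.ofReal (max K₁ K₂ * (ρ / R) ^ min l₁ l₂) := by
    intro K l hK0 hK hl
    apply ENNReal.ofReal_le_ofReal
    exact mul_le_mul hK (Real.rpow_le_rpow_of_exponent_ge hq0 hq1 hl) (Real.rpow_nonneg hq0.le _)
      (hK0.trans hK)
  by_cases hin : Metric.closedBall x (4 * R) ⊆ D.carrier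
  · have hδ' : δ ∈ Set.Ioc (0 : ℝ) δ₁ := ⟨hδ.1, hδ.2.trans (min_le_left _ _)⟩
    have h := h₁ δ hδ' x ρ R hδρ hρR hR1 hin
    dsimp only
    rw [if_pos hin]
    exact h.trans (mono hK₁ (le_max_left _ _) (min_le_left _ _))
  · have hδ' : δ ∈ Set.Ioc (0 : ℝ) δ₂ := ⟨hδ.1, hδ.2.trans (min_le_right _ _)⟩
    have h := h₂ δ hδ' x ρ R hδρ hρR hR1 hin
    dsimp only
    rw [if_neg hin]
    exact h.trans (mono hK₂ (le_max_right _ _) (min_le_right _ _))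

/-- COMPOSITION: the six stub STATEMENTS imply the crux statement (hypotheses are the statements of
`stub_multiStrandStripGap`, `stub_cleanSquareDive`, `stub_cascadeContraction`, `stub_topExcursionTail`,
`stub_pinnedCascade`, `stub_boundaryShells`, in this order; the conclusion is the body of the crux decl).
S1, S2 and the route's two hypotheses feed S3; S3 + S4 feed S5 (interior shells); S6 gives the boundary
shells; the glue above assembles (H1). -/
theorem composition :
    MultiStrandStripGap →
    CleanSquareDive →
    (MultiStrandStripGap → CleanSquareDive → BoundaryTP2 → CriticalBubbleBound →
      SquareCascadeContraction) →
    TopExcursionTail →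
    (SquareCascadeContraction → TopExcursionTail → InteriorTraversalBound) →
    BoundaryTraversalBound →
    (BoundaryTP2 → CriticalBubbleBound → SAWTraversalBound) :=
  fun h1 h2 h3 h4 h5 h6 htp hb =>
    traversalBound_of_interior_of_boundary (h5 (h3 h1 h2 htp hb) h4) h6

/-- THE SKELETON THEOREM: the crux BY NAME from the six registered stubs (sorries live only inside `stub_*`;
this declaration is itself sorry-free and becomes the crux proof when the stubs land). -/
theorem TPToTraversalBound_of :
    Summit.CriticalPhenomena.SAWScalingLimit.Theses.SAWTotalPositivity.TPToTraversalBound :=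
  composition stub_multiStrandStripGap stub_cleanSquareDive stub_cascadeContraction stub_topExcursionTail
    stub_pinnedCascade stub_boundaryShells

end Summit.CriticalPhenomena.SAWScalingLimit.Cruxes.TPToTraversalBound.CriticalStripGap
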